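/-
Copyright (c) 2026. All rights reserved.
Released under Apache 2.0 license as described in the file LICENSE.
Authors: abc-iut cell, wave-2 seat abc-iut-L3-t11 (statements + glue; row «PRODUCER-OBLIGATIONS STATEMENTS
FILE» of G10 rung 3b: the per-level branch dictionary as four named obligations).
-/
import Literature.AnabelianGeometry.SemiGraphs.TemperedLevelData
import Literature.AnabelianGeometry.SemiGraphs.TemperedBranchPairProducer
import HarnessLib

/-!
# [SemiAnbd] Thm 3.7 (iii): the per-level branch dictionary — producer obligations (DV), (DB), (DI), (DN)

Mochizuki, *Semi-graphs of anabelioids*, Publ. RIMS **42** (2006) [MochizukiSemiAnbd2006], Thm 3.7 (iii) with the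
author's *Comments* (2020), (6)(b) ("converge, in the profinite topology, to some profinite subjoint … [cf.
Remark 2.2.1] … in the profinite fundamental group `π̂₁(G)`"), Remark 2.2.1 p. 24 (images of `Π_v`, `Π_b` are
the stabilisers of the vertex / branch), Definition 2.2 (i) p. 23 (branches over `b` at `v'` ↔ double cosets).

The finite-level data of abc-iut-L3-t10's `FiniteLevelData` (the trees, the finite graphs `𝔾_j`, the
graph-coverings, the actions, the transitions) carry ONE anabelioid axiom, the branch-level identification (I4′)
`stabBranchPair'`. `TemperedBranchPairProducer.lean` (p411058) proves (I4′) from a PER-LEVEL dictionary in a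
compact overgroup `Q ⊇ π₁^temp(𝒢)`. This file packages that dictionary as DATA (`LevelDictionary`: the
finite-level fields of `FiniteLevelData` minus `stabBranchPair'`, plus the structure maps `𝔾_j → 𝔾`, the
compact overgroup `Q` with its actions, reference embeddings `ψ_v : Π_v → Q` and double-coset representatives
`rep`) and FOUR NAMED OBLIGATIONS on it — Prop-valued, one per producer row:
* `LevelDictionary.DV` (P1) — vertex stabilisers: `Stab_Q(w) = γ·ψ_v(Π_v)·γ⁻¹·M_j` (Rmk 2.2.1, vertices);
* `LevelDictionary.DB` (P2) — branch stabilisers: `Stab_Q(w, β) = γ·ψ_v(y·Π_b·y⁻¹)·γ⁻¹·M_j`, `y = rep …`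
  (Rmk 2.2.1, branches);
* `LevelDictionary.DI` (P3) — distinct branches over the same `b` have distinct double cosets `M̃_j·y·Π_b`
  (Def 2.2 (i), injectivity);
* `LevelDictionary.DN` (P4) — the double cosets are compatible with the transition maps (Def 2.2 (i),
  naturality);
and the GLUE `LevelDictionary.toFiniteLevelData (X) (h₁ : X.DV) (h₂ : X.DB) (h₃ : X.DI) (h₄ : X.DN) :
FiniteLevelData 𝒢 c` (the (I4′) field supplied by `stabBranchPair'_of_levelDictionary`). A producer (the Galois
tower of `B^temp(𝒢)`, G10 rung 1) thus builds `X` and proves four single-level statements; the cross-level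
compactness arguments are already done. Typed ≠ proved: the four obligations are stated, not discharged, here.
-/

namespace Literature.AnabelianGeometry.SemiGraphs

namespace ProfiniteSemiGraph

open CategoryTheory Topology
open scoped Pointwise

universe v u

variable {𝒢 : ProfiniteSemiGraph.{u}}

/-- **The per-level branch dictionary data** over a chart `c` of `π₁^temp(𝒢)`: the tree-level data
(`VerticialLevelData`), the finite levels `𝔾_j` with their graph-coverings, actions and transitions (as in
`FiniteLevelData`), their structure maps to `𝔾`, a compact Hausdorff overgroup `ιQ : π₁^temp(𝒢) ↪ Q` acting
compatibly on the levels with open antitone kernels meeting in `1` (print: the profinite completion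
`π̂₁(G)`), reference embeddings `ψ_v : Π_v → Q`, and chosen double-coset representatives `rep`.
[cite: MochizukiSemiAnbd2006, Rmk. 2.2.1 p.24] -/
structure LevelDictionary (𝒢 : ProfiniteSemiGraph.{u}) (c : TemperedPiChart 𝒢)
    extends VerticialLevelData.{v} 𝒢 c where
  /-- the finite semi-graphs `𝔾_j` underlying the finite étale Galois coverings `𝒢_j → 𝒢` -/
  level : J → SemiGraph.{u}
  [finiteVertex : ∀ j, Finite (level j).Vertex]
  [finiteBranch : ∀ j, Finite (level j).Branch]
  /-- the universal graph-coverings `𝒢_{∞,j} → 𝔾_j` -/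
  quot : ∀ j, tree j ⟶ level j
  /-- graph-coverings are immersions -/
  quot_isImmersion : ∀ j, SemiGraph.IsImmersion (quot j)
  /-- the induced actions on the finite levels -/
  levelAct : ∀ j, c.G →* Aut (level j)
  /-- `quot` is equivariant -/
  act_quot : ∀ (j : J) (g : c.G), (act j g).hom ≫ quot j = quot j ≫ (levelAct j g).hom
  /-- the transition morphisms `𝔾_j → 𝔾_i`, `i ≤ j` -/
  levelTrans : ∀ ⦃i j : J⦄, i ≤ j → (level j ⟶ level i)
  /-- functoriality: identities -/
  levelTrans_id : ∀ j, levelTrans (le_refl j) = 𝟙 (level j)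
  /-- functoriality: composition -/
  levelTrans_comp : ∀ ⦃i j k : J⦄ (hij : i ≤ j) (hjk : j ≤ k),
    levelTrans hjk ≫ levelTrans hij = levelTrans (hij.trans hjk)
  /-- the finite-level transition morphisms are equivariant -/
  levelTrans_act : ∀ ⦃i j : J⦄ (h : i ≤ j) (g : c.G),
    (levelAct j g).hom ≫ levelTrans h = levelTrans h ≫ (levelAct i g).hom
  /-- the transition morphisms of the trees cover those of the finite levels -/
  trans_quot : ∀ ⦃i j : J⦄ (h : i ≤ j), trans h ≫ quot i = quot j ≫ levelTrans h
  /-- the structure maps `𝔾_j → 𝔾` -/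
  levelProj : ∀ j, level j ⟶ 𝒢.graph
  /-- the structure maps are compatible with the transitions -/
  levelProj_trans : ∀ ⦃i j : J⦄ (h : i ≤ j), levelTrans h ≫ levelProj i = levelProj j
  /-- the compact overgroup `Q` (print: `π̂₁(G)`) -/
  Q : Type u
  [groupQ : Group Q]
  [topologicalSpaceQ : TopologicalSpace Q]
  [isTopologicalGroupQ : IsTopologicalGroup Q]
  [compactSpaceQ : CompactSpace Q]
  [t2SpaceQ : T2Space Q]
  /-- `π₁^temp(𝒢) → Q` -/
  ιQ : c.G →* Q
  /-- … is injective (residual finiteness with respect to the finite levels, Prop 3.6 (iii)) -/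
  ιQ_injective : Function.Injective ιQ
  /-- the actions of `Q` on the finite levels -/
  qAct : ∀ j, Q →* Aut (level j)
  /-- … extending those of `π₁^temp(𝒢)` -/
  qAct_ιQ : ∀ (j : J) (g : c.G), qAct j (ιQ g) = levelAct j g
  /-- the level kernels `M_j` are open -/
  isOpen_ker_qAct : ∀ j, IsOpen ((qAct j).ker : Set Q)
  /-- … antitone -/
  ker_qAct_anti : ∀ ⦃i j : J⦄, i ≤ j → (qAct j).ker ≤ (qAct i).ker
  /-- … and meet in `1` (`Q` is the completion with respect to the levels) -/
  ker_qAct_trivial : ∀ q : Q, (∀ j, q ∈ (qAct j).ker) → q = 1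
  /-- the `Q`-actions are compatible with the transitions (on vertices) -/
  qAct_trans : ∀ ⦃i j : J⦄ (h : i ≤ j) (q : Q) (x : (level j).Vertex),
    (levelTrans h).vertexMap ((qAct j q).hom.vertexMap x) = (qAct i q).hom.vertexMap ((levelTrans h).vertexMap x)
  /-- the reference embeddings `ψ_v : Π_v → Q` -/
  ψ : ∀ v : 𝒢.graph.Vertex, 𝒢.Gv v →* Q
  /-- … injective -/
  ψ_injective : ∀ v, Function.Injective (ψ v)
  /-- … continuous -/
  ψ_continuous : ∀ v, Continuous (ψ v)
  /-- chosen double-coset representatives `y_β ∈ Π_v` of the branches of the finite levels -/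
  rep : ∀ (j : J) (_ : (level j).Vertex) (v : 𝒢.graph.Vertex) (_ : Q) (_ : (level j).Branch), 𝒢.Gv v

attribute [instance] LevelDictionary.finiteVertex LevelDictionary.finiteBranch LevelDictionary.groupQ
  LevelDictionary.topologicalSpaceQ LevelDictionary.isTopologicalGroupQ LevelDictionary.compactSpaceQ
  LevelDictionary.t2SpaceQ

namespace LevelDictionary

variable {c : TemperedPiChart 𝒢} (X : LevelDictionary.{v} 𝒢 c)

/-- **(P1) = (DV), vertex stabilisers** (Remark 2.2.1 for vertices, one finite level): the `Q`-stabiliser of a vertex `w` of `𝔾_j` over `v` is `γ·ψ_v(Π_v)·γ⁻¹·M_j` for some `γ ∈ Q`. [cite: MochizukiSemiAnbd2006, Rmk. 2.2.1 p.24] -/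
def DV : Prop :=
  ∀ (j : X.J) (w : (X.level j).Vertex) (v : 𝒢.graph.Vertex), (X.levelProj j).vertexMap w = v →
      ∃ γ : X.Q, ∀ q : X.Q, (X.qAct j q).hom.vertexMap w = w ↔
        q ∈ ((X.ψ v).range.map (MulAut.conj γ).toMonoidHom) ⊔ (X.qAct j).ker

/-- **(P2) = (DB), branch stabilisers** (Remark 2.2.1 for branches, one finite level): for `γ` as in (DV), the `Q`-stabiliser of `(w, β)`, `β` a branch at `w` over `b`, is `γ·ψ_v(y·Π_b·y⁻¹)·γ⁻¹·M_j` with `y = rep j w v γ β`. [cite: MochizukiSemiAnbd2006, Rmk. 2.2.1 p.24] -/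
def DB : Prop :=
  ∀ (j : X.J) (w : (X.level j).Vertex) (v : 𝒢.graph.Vertex) (_ : (X.levelProj j).vertexMap w = v) (γ : X.Q),
      (∀ q : X.Q, (X.qAct j q).hom.vertexMap w = w ↔ q ∈ ((X.ψ v).range.map (MulAut.conj γ).toMonoidHom) ⊔ (X.qAct j).ker) →
      ∀ (β : (X.level j).Branch) (_ : (X.level j).abuts β = some w) (b : 𝒢.graph.Branch)
        (_ : (X.levelProj j).branchMap β = b) (hb : 𝒢.graph.abuts b = some v),
        ∀ q : X.Q, ((X.qAct j q).hom.vertexMap w = w ∧ (X.qAct j q).hom.branchMap β = β) ↔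
          q ∈ (((𝒢.branchSubgroup b v hb).map (MulAut.conj (X.rep j w v γ β)).toMonoidHom).map (X.ψ v)).map
            (MulAut.conj γ).toMonoidHom ⊔ (X.qAct j).ker

/-- **(P3) = (DI), injectivity of the branch dictionary** (Definition 2.2 (i), one finite level): distinct branches at `w` over the same `b` have distinct double cosets `M̃_j·y·Π_b` (`M̃_j` the level inside `Π_v`). [cite: MochizukiSemiAnbd2006, Def. 2.2(i) p.23] -/
def DI : Prop :=
  ∀ (j : X.J) (w : (X.level j).Vertex) (v : 𝒢.graph.Vertex) (_ : (X.levelProj j).vertexMap w = v) (γ : X.Q),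
      (∀ q : X.Q, (X.qAct j q).hom.vertexMap w = w ↔ q ∈ ((X.ψ v).range.map (MulAut.conj γ).toMonoidHom) ⊔ (X.qAct j).ker) →
      ∀ (β β' : (X.level j).Branch), (X.level j).abuts β = some w → (X.level j).abuts β' = some w →
        ∀ (b : 𝒢.graph.Branch) (hb : 𝒢.graph.abuts b = some v),
        (X.levelProj j).branchMap β = b → (X.levelProj j).branchMap β' = b → β ≠ β' →
        X.rep j w v γ β' ∉ (((X.qAct j).ker.comap ((MulAut.conj γ).toMonoidHom.comp (X.ψ v)) : Subgroup (𝒢.Gv v)) :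
          Set (𝒢.Gv v)) * {X.rep j w v γ β} * (𝒢.branchSubgroup b v hb : Set (𝒢.Gv v))

/-- **(P4) = (DN), naturality of the branch dictionary** (Definition 2.2 (i) under a transition `𝔾_j → 𝔾_i`): the representative of `β` lies in the level-`i` double coset of the image branch. [cite: MochizukiSemiAnbd2006, Def. 2.2(i) p.23] -/
def DN : Prop :=
  ∀ ⦃i j : X.J⦄ (h : i ≤ j) (w : (X.level j).Vertex) (v : 𝒢.graph.Vertex) (_ : (X.levelProj j).vertexMap w = v)
      (γ : X.Q),
      (∀ q : X.Q, (X.qAct j q).hom.vertexMap w = w ↔ q ∈ ((X.ψ v).range.map (MulAut.conj γ).toMonoidHom) ⊔ (X.qAct j).ker) →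
      (∀ q : X.Q, (X.qAct i q).hom.vertexMap ((X.levelTrans h).vertexMap w) = (X.levelTrans h).vertexMap w ↔
        q ∈ ((X.ψ v).range.map (MulAut.conj γ).toMonoidHom) ⊔ (X.qAct i).ker) →
      ∀ (β : (X.level j).Branch), (X.level j).abuts β = some w → ∀ (b : 𝒢.graph.Branch)
        (hb : 𝒢.graph.abuts b = some v), (X.levelProj j).branchMap β = b →
        X.rep j w v γ β ∈ (((X.qAct i).ker.comap ((MulAut.conj γ).toMonoidHom.comp (X.ψ v)) : Subgroup (𝒢.Gv v)) :
          Set (𝒢.Gv v)) * {X.rep i ((X.levelTrans h).vertexMap w) v γ ((X.levelTrans h).branchMap β)} *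
            (𝒢.branchSubgroup b v hb : Set (𝒢.Gv v))

/-- **The glue**: a level dictionary satisfying the four obligations yields abc-iut-L3-t10's `FiniteLevelData`
— the identification (I4′) `stabBranchPair'` being `stabBranchPair'_of_levelDictionary` — and hence, through
`FiniteLevelData`, the second conjunct of `CompactInVerticial`. [cite: MochizukiSemiAnbd2006, Thm 3.7(iii) p.41] -/
noncomputable def toFiniteLevelData (h₁ : X.DV) (h₂ : X.DB) (h₃ : X.DI) (h₄ : X.DN) :
    FiniteLevelData.{v} 𝒢 c where
  toVerticialLevelData := X.toVerticialLevelData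
  level := X.level
  quot := X.quot
  quot_isImmersion := X.quot_isImmersion
  levelAct := X.levelAct
  act_quot := X.act_quot
  levelTrans := X.levelTrans
  levelTrans_id := X.levelTrans_id
  levelTrans_comp := X.levelTrans_comp
  levelTrans_act := X.levelTrans_act
  trans_quot := X.trans_quot
  stabBranchPair' :=
    stabBranchPair'_of_levelDictionary c X.level X.levelAct X.levelTrans X.levelProj X.levelProj_trans X.Q
      X.ιQ X.ιQ_injective X.qAct X.qAct_ιQ X.isOpen_ker_qAct X.ker_qAct_anti X.ker_qAct_trivial X.qAct_trans
      X.ψ X.ψ_injective X.ψ_continuous X.rep h₁ h₂ h₃ h₄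

end LevelDictionary

end ProfiniteSemiGraph

end Literature.AnabelianGeometry.SemiGraphs
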